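import Literature.Probability.RandomPlanarGeometry.SAWHutchcroftTheorem12
import Literature.Probability.RandomPlanarGeometry.BDGS2012CountBoundsProofs
import HarnessLib

/-!
# From bridges to walks in DCH 2013 §2.4: axial symmetry and the exponent bookkeeping (lane «DCH-1.1», K4a + K4)

Topic `Literature/Probability/RandomPlanarGeometry` (continues `SAWSubBallistic.lean`: `Zd.maxDisplacementEvent`, `Zd.euclidNorm`,
`Zd.DuminilCopinHammond2013_thm1_1`; `SAWHutchcroftTheorem12.lean`: `Zd.DuminilCopinHammond2013_bridgeNotBallistic`;
the companion file `SAWMaxHeightUnfolding.lean` proves the third input, the max-height-monotone unfolding K4b).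

Source: H. Duminil-Copin, A. Hammond, *Self-avoiding walk is sub-ballistic*, Commun. Math. Phys. 324 (2013), §2.4
(arXiv:1205.0401, pp. 6–7): "`P_{SAW_n}(max ‖γ_k‖ ≥ vn) ≤ 2d · P_{SAW_n}(max y(γ_k) ≥ d^{-1/2} v n)`" by the symmetries of
`ℤ^d`, then the unfolding into bridges. Lane «pcv-sawmu» route «DCH-1.1» (a-idea-2 `Sketch_v8_DCH11.lean` 0598f4a123035069):
the typed nodes K4a `AxialReduction` and K4 `Sec24_of` are proved here VERBATIM (bodies inlined: the Props themselves are
planner objects, not tree declarations).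

## Contents (namespace `Literature.Probability.RandomPlanarGeometry.SAW.Zd`; theorems only)
* `exists_coord_abs_ge` — a site of Euclidean norm `≥ r` has a coordinate of modulus `≥ r/√d`;
* `signSwapWalk_mem_saws`, `signSwapWalk_injective` — the hyperoctahedral symmetry `ω ↦ (k ↦ (j ↦ s · ω_k(swap 0 i j)))`,
  `s = ±1`, preserves `saws d n`;
* **`axialReduction`** (K4a): `#{max_k ‖ω_k‖ ≥ vn} ≤ 2d · #{∃ k, vn/√d ≤ y(ω_k)}`;
* **`sec24_of`** (K4): `AxialReduction → MaxHeightUnfolding → bridgeNotBallistic → DuminilCopinHammond2013_thm1_1`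
  (with `b_{n+1} ≤ c_{n+1} ≤ 2d c_n` and the threshold bookkeeping; rate `c/2`).
Tree-twin search: stems `axial`, `sec24`, `signSwap`, `maxDisplacementEvent.*card` → only the conditional consumers in
`SAWSubBallistic*.lean` (ℤ² certificates) and `SAWHutchcroftTheorem12.lean`. No twin.
-/

noncomputable section

open Finset Filter Topology Literature.Probability.LatticeModels Literature.Probability.Percolation SimpleGraph
open scoped BigOperators

namespace Literature.Probability.RandomPlanarGeometry.SAW.Zd

variable {d : ℕ} [NeZero d]

/-! ### A large Euclidean norm forces a large coordinate -/

/-- If `r ≤ ‖u‖` (`r ≥ 0`) then some coordinate has `r/√d ≤ |u_i|`. [cite: DuminilCopinHammond2013, §2.4] -/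
theorem exists_coord_abs_ge (u : Site d) {r : ℝ} (hr : 0 ≤ r) (h : r ≤ euclidNorm u) :
    ∃ i : Fin d, r / Real.sqrt d ≤ |((u i : ℤ) : ℝ)| := by
  by_contra hno
  simp only [not_exists, not_le] at hno
  have hd : (0 : ℝ) < d := by exact_mod_cast Nat.pos_of_ne_zero (NeZero.ne d)
  have hsd : 0 < Real.sqrt d := Real.sqrt_pos.2 hd
  -- every square is `< r²/d`, so the sum is `< r²`
  have hsq : ∀ i : Fin d, ((u i : ℤ) : ℝ) ^ 2 < r ^ 2 / d := by
    intro i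
    have h1 := hno i
    have h2 : |((u i : ℤ) : ℝ)| ^ 2 < (r / Real.sqrt d) ^ 2 := by
      exact pow_lt_pow_left₀ h1 (abs_nonneg _) two_ne_zero
    rw [sq_abs, div_pow, Real.sq_sqrt hd.le] at h2
    exact h2
  have hsum : ∑ i : Fin d, ((u i : ℤ) : ℝ) ^ 2 < r ^ 2 := by
    calc ∑ i : Fin d, ((u i : ℤ) : ℝ) ^ 2 < ∑ _i : Fin d, r ^ 2 / d :=
          Finset.sum_lt_sum_of_nonempty ⟨0, Finset.mem_univ _⟩ fun i _ => hsq i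
      _ = r ^ 2 := by rw [Finset.sum_const, Finset.card_univ, Fintype.card_fin, nsmul_eq_mul]; field_simp
  have : euclidNorm u < r := by
    unfold euclidNorm
    calc Real.sqrt (∑ i, ((u i : ℤ) : ℝ) ^ 2) < Real.sqrt (r ^ 2) := Real.sqrt_lt_sqrt (by positivity) hsum
      _ = r := Real.sqrt_sq hr
  linarith

/-! ### The hyperoctahedral symmetries of `saws d n` -/

/-- The symmetry `(k ↦ (j ↦ s · ω_k(swap 0 i j)))` (swap the coordinates `0, i`, multiply by the sign `s = ±1`)
maps `n`-step self-avoiding walks from the origin to themselves. [cite: MadrasSlade1993, §1.1 (symmetries of ℤ^d)] -/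
theorem signSwapWalk_mem_saws {n : ℕ} {ω : ℕ → Site d} (hω : ω ∈ saws d n) (i : Fin d) {s : ℤ}
    (hs : s = 1 ∨ s = -1) :
    (fun k => fun j => s * ω k (Equiv.swap 0 i j)) ∈ saws d n := by
  obtain ⟨h0, hend, hadj, hinj⟩ := mem_saws.1 hω
  have hs0 : s ≠ 0 := by rcases hs with rfl | rfl <;> norm_num
  refine mem_saws.2 ⟨?_, fun k hk => ?_, fun k hk => ?_, fun a ha b hb hab => ?_⟩
  · funext j; simp [h0]
  · funext j; simp [hend k hk]
  · have h := hadj k hk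
    rw [zdGraph_adj_iff_sub] at h ⊢
    obtain ⟨c, hc⟩ := h
    refine ⟨Equiv.swap 0 i c, ?_⟩
    have key : ∀ (x y : Site d), y - x = Pi.single c 1 →
        ((fun j => s * y (Equiv.swap 0 i j)) - fun j => s * x (Equiv.swap 0 i j)) =
          s • (Pi.single (Equiv.swap 0 i c) (1 : ℤ) : Site d) := by
      intro x y hxy
      funext j
      have hj := congrFun hxy (Equiv.swap 0 i j)
      simp only [Pi.sub_apply] at hj
      simp only [Pi.sub_apply, Pi.smul_apply, smul_eq_mul, Pi.single_apply]
      rw [← mul_sub, hj, Pi.single_apply]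
      have : (Equiv.swap 0 i j = c) ↔ (j = Equiv.swap 0 i c) := by
        constructor
        · intro h; rw [← h, Equiv.swap_apply_self]
        · intro h; rw [h, Equiv.swap_apply_self]
      simp only [this]
    rcases hc with hc | hc
    · rcases hs with rfl | rfl
      · left; rw [key _ _ hc]; simp
      · right
        have e := key _ _ hc
        rw [← neg_sub, neg_eq_iff_eq_neg] at e
        rw [e]; simp
    · rcases hs with rfl | rfl
      · right; rw [key _ _ hc]; simp
      · left
        have e := key _ _ hc
        rw [← neg_sub, neg_eq_iff_eq_neg] at e
        rw [e]; simp
  · simp only [Set.mem_setOf_eq] at ha hb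
    apply hinj ha hb
    funext j
    have := congrFun hab (Equiv.swap 0 i j)
    simp only [Equiv.swap_apply_self] at this
    exact mul_left_cancel₀ hs0 this

/-- The symmetry is injective. [cite: MadrasSlade1993, §1.1 (symmetries of ℤ^d)] -/
theorem signSwapWalk_injective (i : Fin d) {s : ℤ} (hs : s = 1 ∨ s = -1) :
    Function.Injective fun (ω : ℕ → Site d) => fun k => fun j => s * ω k (Equiv.swap 0 i j) := by
  have hs0 : s ≠ 0 := by rcases hs with rfl | rfl <;> norm_num
  intro ω ω' h
  funext k j
  have := congrFun (congrFun h k) (Equiv.swap 0 i j)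
  simp only [Equiv.swap_apply_self] at this
  exact mul_left_cancel₀ hs0 this

/-! ### K4a — axial reduction -/

open Classical in
/-- **K4a `AxialReduction` (DCH §2.4, first display of the proof of Theorem 1.1), as counts**:
`#{ω ∈ S_n : ∃ k ≤ n, vn ≤ ‖ω_k‖} ≤ 2d · #{ω ∈ S_n : ∃ k ≤ n, vn/√d ≤ y(ω_k)}` — some signed coordinate of a point of norm
`≥ vn` is `≥ vn/√d`, and the `2d` signed coordinate directions are exchanged by symmetries of `saws d n`.
[cite: DuminilCopinHammond2013, §2.4 (arXiv v1, p. 10)] -/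
theorem axialReduction :
    ∀ (d : ℕ) [NeZero d] (n : ℕ) (v : ℝ), 0 ≤ v →
      ((maxDisplacementEvent d n v).card : ℝ) ≤
        2 * d * (((saws d n).filter fun ω => ∃ k ≤ n, v * (n : ℝ) / Real.sqrt d ≤ ((ω k 0 : ℤ) : ℝ)).card : ℝ) := by
  intro d _ n v hv
  set T := (saws d n).filter fun ω => ∃ k ≤ n, v * (n : ℝ) / Real.sqrt d ≤ ((ω k 0 : ℤ) : ℝ) with hT
  -- the `2d` pieces, indexed by a coordinate and a sign
  set sgn : Bool → ℤ := fun b => if b then 1 else -1 with hsgn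
  have hsgn1 : ∀ b, sgn b = 1 ∨ sgn b = -1 := fun b => by cases b <;> simp [hsgn]
  set A : Fin d × Bool → Finset (ℕ → Site d) := fun p =>
    (saws d n).filter fun ω => ∃ k ≤ n, v * (n : ℝ) / Real.sqrt d ≤ (sgn p.2 : ℝ) * ((ω k p.1 : ℤ) : ℝ) with hA
  -- covering
  have hcov : maxDisplacementEvent d n v ⊆ (Finset.univ : Finset (Fin d × Bool)).biUnion A := by
    intro ω hω
    rw [mem_maxDisplacementEvent] at hω
    obtain ⟨hωs, k, hk, hnorm⟩ := hω
    obtain ⟨i, hi⟩ := exists_coord_abs_ge (ω k) (by positivity) hnorm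
    rw [Finset.mem_biUnion]
    rcases le_or_gt 0 ((ω k i : ℤ) : ℝ) with hpos | hneg
    · refine ⟨(i, true), Finset.mem_univ _, ?_⟩
      simp only [hA, Finset.mem_filter]
      refine ⟨hωs, k, hk, ?_⟩
      rw [abs_of_nonneg hpos] at hi
      simpa [hsgn] using hi
    · refine ⟨(i, false), Finset.mem_univ _, ?_⟩
      simp only [hA, Finset.mem_filter]
      refine ⟨hωs, k, hk, ?_⟩
      rw [abs_of_neg hneg] at hi
      simpa [hsgn] using hi
  -- each piece injects into `T`
  have hpiece : ∀ p : Fin d × Bool, (A p).card ≤ T.card := by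
    rintro ⟨i, b⟩
    refine Finset.card_le_card_of_injOn (fun ω => fun k => fun j => sgn b * ω k (Equiv.swap 0 i j))
      (fun ω hω => ?_) (fun ω _ ω' _ h => signSwapWalk_injective i (hsgn1 b) h)
    rw [Finset.mem_coe, hA, Finset.mem_filter] at hω
    obtain ⟨hωs, k, hk, hle⟩ := hω
    rw [Finset.mem_coe, hT, Finset.mem_filter]
    refine ⟨signSwapWalk_mem_saws hωs i (hsgn1 b), k, hk, ?_⟩
    simp only [Equiv.swap_apply_left]
    push_cast
    exact hle
  calc ((maxDisplacementEvent d n v).card : ℝ)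
      ≤ (((Finset.univ : Finset (Fin d × Bool)).biUnion A).card : ℝ) := by exact_mod_cast Finset.card_le_card hcov
    _ ≤ ((∑ p : Fin d × Bool, (A p).card : ℕ) : ℝ) := by exact_mod_cast Finset.card_biUnion_le
    _ ≤ ((∑ _p : Fin d × Bool, T.card : ℕ) : ℝ) := by exact_mod_cast Finset.sum_le_sum fun p _ => hpiece p
    _ = 2 * d * (T.card : ℝ) := by
        rw [Finset.sum_const, Finset.card_univ, Fintype.card_prod, Fintype.card_fin, Fintype.card_bool, smul_eq_mul]
        push_cast; ring


/-! ### K4 — §2.4 bookkeeping: from `bridgeNotBallistic` to Theorem 1.1 -/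

/-- AM–GM step for the exponents: `C√(n+1) ≤ (c/8)(n+1) + 2C²/c` (`c > 0`). [folklore] -/
private theorem sqrt_linear_bound (C : ℝ) {c : ℝ} (hc : 0 < c) (n : ℕ) :
    C * Real.sqrt ((n : ℝ) + 1) ≤ c / 8 * ((n : ℝ) + 1) + 2 * C ^ 2 / c := by
  have hs := Real.sq_sqrt (show (0 : ℝ) ≤ (n : ℝ) + 1 by positivity)
  have h0 : 0 ≤ (c * Real.sqrt ((n : ℝ) + 1) - 4 * C) ^ 2 := sq_nonneg _
  have key : c * (c / 8 * ((n : ℝ) + 1) + 2 * C ^ 2 / c - C * Real.sqrt ((n : ℝ) + 1)) =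
      (c * Real.sqrt ((n : ℝ) + 1) - 4 * C) ^ 2 / 8 := by
    field_simp
    nlinarith [hs]
  have : 0 ≤ c * (c / 8 * ((n : ℝ) + 1) + 2 * C ^ 2 / c - C * Real.sqrt ((n : ℝ) + 1)) := by
    rw [key]; positivity
  nlinarith

open Classical in
/-- **K4 `Sec24_of` (DCH §2.4): the typed nodes K4a (axial reduction) and K4b (max-height-monotone unfolding) turn
"bridges are not ballistic" (`DuminilCopinHammond2013_bridgeNotBallistic`, every `d ≥ 2`, every speed) into Theorem 1.1
(rate `c/2`, using `b_{n+1} ≤ c_{n+1} ≤ 2d c_n`).** The two hypotheses are the bodies of the planner's Props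
`AxialReduction` / `MaxHeightUnfolding` (a-idea-2 `Sketch_v8_DCH11.lean`) verbatim; K4a is `axialReduction` above,
K4b is `SAWMaxHeightUnfolding.maxHeightUnfolding`. [cite: DuminilCopinHammond2013, §2.4 (arXiv v1, p. 10)] -/
theorem sec24_of
    (hK4a : ∀ (d : ℕ) [NeZero d] (n : ℕ) (v : ℝ), 0 ≤ v →
      ((maxDisplacementEvent d n v).card : ℝ) ≤
        2 * d * (((saws d n).filter fun ω => ∃ k ≤ n, v * (n : ℝ) / Real.sqrt d ≤ ((ω k 0 : ℤ) : ℝ)).card : ℝ))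
    (hK4b : ∀ (d : ℕ) [NeZero d], 2 ≤ d → ∃ C : ℝ, ∀ (n : ℕ) (H : ℤ),
      (((saws d n).filter fun ω => ∃ k ≤ n, H ≤ ω k 0).card : ℝ) ≤
        Real.exp (C * Real.sqrt ((n : ℝ) + 1)) *
          (((bridges d (n + 1)).filter fun ω => H ≤ ω (n + 1) 0).card : ℝ))
    (hbr : DuminilCopinHammond2013_bridgeNotBallistic) : DuminilCopinHammond2013_thm1_1 := by
  intro d hd v hv
  haveI : NeZero d := ⟨by omega⟩
  have hd0 : (0 : ℝ) < d := by exact_mod_cast (show 0 < d by omega)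
  have hsd : 0 < Real.sqrt d := Real.sqrt_pos.2 hd0
  -- the bridge input at speed `v' = v/(2√d)` and the unfolding constant
  set v' : ℝ := v / (2 * Real.sqrt d) with hv'
  have hv'0 : 0 < v' := by positivity
  obtain ⟨c, hc, n₁, hbr'⟩ := hbr d hd v' hv'0
  obtain ⟨C, hC⟩ := hK4b d hd
  -- thresholds
  set L : ℝ := Real.log (4 * (d : ℝ) ^ 2) with hL
  have hL0 : 0 ≤ L := Real.log_nonneg (by
    have : (1 : ℝ) ≤ (d : ℝ) := by exact_mod_cast (show 1 ≤ d by omega)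
    nlinarith)
  set K : ℝ := 2 * C ^ 2 / c + L with hK
  have hK0 : 0 ≤ K := by positivity
  set n₂ : ℕ := ⌈8 * K / (3 * c)⌉₊ with hn₂
  refine ⟨c / 2, by positivity, max n₁ (max n₂ 1), fun n hn => ?_⟩
  have hn1 : n₁ ≤ n := le_trans (le_max_left _ _) hn
  have hn2 : n₂ ≤ n := le_trans ((le_max_left _ _).trans (le_max_right _ _)) hn
  have hn3 : 1 ≤ n := le_trans ((le_max_right _ _).trans (le_max_right _ _)) hn
  have hnK : K ≤ 3 * c / 8 * n := by
    have h1 : 8 * K / (3 * c) ≤ n₂ := Nat.le_ceil _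
    have h2 : (n₂ : ℝ) ≤ n := by exact_mod_cast hn2
    have : 8 * K / (3 * c) ≤ n := h1.trans h2
    rw [div_le_iff₀ (by positivity)] at this
    linarith
  -- the count chain
  have hcn : (0 : ℝ) < count d n := by exact_mod_cast one_le_count d n
  set H : ℤ := ⌈v * (n : ℝ) / Real.sqrt d⌉ with hH
  have step1 := hK4a d n v hv.le
  have step2 : (((saws d n).filter fun ω => ∃ k ≤ n, v * (n : ℝ) / Real.sqrt d ≤ ((ω k 0 : ℤ) : ℝ)).card : ℝ) ≤
      (((saws d n).filter fun ω => ∃ k ≤ n, H ≤ ω k 0).card : ℝ) := by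
    refine Nat.cast_le.2 (Finset.card_le_card fun ω hω => ?_)
    rw [Finset.mem_filter] at hω ⊢
    obtain ⟨hωs, k, hk, hle⟩ := hω
    exact ⟨hωs, k, hk, Int.ceil_le.2 hle⟩
  have step3 := hC n H
  have step4 : (((bridges d (n + 1)).filter fun ω => H ≤ ω (n + 1) 0).card : ℝ) ≤
      (((bridges d (n + 1)).filter fun ω => v' * ((n + 1 : ℕ) : ℝ) ≤ ((ω (n + 1) 0 : ℤ) : ℝ)).card : ℝ) := by
    refine Nat.cast_le.2 (Finset.card_le_card fun β hβ => ?_)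
    rw [Finset.mem_filter] at hβ ⊢
    refine ⟨hβ.1, ?_⟩
    have h1 : v * (n : ℝ) / Real.sqrt d ≤ ((β (n + 1) 0 : ℤ) : ℝ) := by
      have := Int.le_ceil (v * (n : ℝ) / Real.sqrt d)
      rw [← hH] at this
      exact this.trans (by exact_mod_cast hβ.2)
    have h2 : v' * ((n + 1 : ℕ) : ℝ) ≤ v * (n : ℝ) / Real.sqrt d := by
      rw [hv']
      have hn' : ((n + 1 : ℕ) : ℝ) ≤ 2 * (n : ℝ) := by
        have : (1 : ℝ) ≤ n := by exact_mod_cast hn3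
        push_cast; linarith
      rw [div_mul_eq_mul_div, div_le_div_iff₀ (by positivity) hsd]
      have : v * ((n + 1 : ℕ) : ℝ) * Real.sqrt d ≤ v * (2 * (n : ℝ)) * Real.sqrt d := by
        apply mul_le_mul_of_nonneg_right _ hsd.le
        exact mul_le_mul_of_nonneg_left hn' hv.le
      nlinarith
    exact h2.trans h1
  have step5 := hbr' (n + 1) (by omega)
  have step6 : (bridgeCount d (n + 1) : ℝ) ≤ 2 * d * count d n := by
    have h1 : bridgeCount d (n + 1) ≤ count d (n + 1) := bridgeCount_le_count (n + 1)
    have h2 : count d (n + 1) ≤ count d n * count d 1 := count_add_le d n 1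
    have h3 : count d 1 ≤ 2 * d := count_one_le d
    have : (bridgeCount d (n + 1) : ℝ) ≤ count d n * (2 * d) := by
      exact_mod_cast h1.trans (h2.trans (Nat.mul_le_mul_left _ h3))
    linarith
  have hexpC : 0 ≤ Real.exp (C * Real.sqrt ((n : ℝ) + 1)) := Real.exp_nonneg _
  have hmain : ((maxDisplacementEvent d n v).card : ℝ) ≤
      4 * (d : ℝ) ^ 2 * (Real.exp (C * Real.sqrt ((n : ℝ) + 1)) * Real.exp (-(c * ((n + 1 : ℕ) : ℝ)))) * count d n := by
    calc ((maxDisplacementEvent d n v).card : ℝ)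
        ≤ 2 * d * (((saws d n).filter fun ω => ∃ k ≤ n, H ≤ ω k 0).card : ℝ) := step1.trans (by gcongr)
      _ ≤ 2 * d * (Real.exp (C * Real.sqrt ((n : ℝ) + 1)) *
            (((bridges d (n + 1)).filter fun ω => v' * ((n + 1 : ℕ) : ℝ) ≤ ((ω (n + 1) 0 : ℤ) : ℝ)).card : ℝ)) := by
          gcongr
          exact step3.trans (mul_le_mul_of_nonneg_left step4 hexpC)
      _ ≤ 2 * d * (Real.exp (C * Real.sqrt ((n : ℝ) + 1)) *
            (Real.exp (-(c * ((n + 1 : ℕ) : ℝ))) * bridgeCount d (n + 1))) := by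
          gcongr
      _ ≤ 2 * d * (Real.exp (C * Real.sqrt ((n : ℝ) + 1)) *
            (Real.exp (-(c * ((n + 1 : ℕ) : ℝ))) * (2 * d * count d n))) := by
          gcongr
      _ = _ := by ring
  -- exponent bookkeeping
  have hexp : 4 * (d : ℝ) ^ 2 * (Real.exp (C * Real.sqrt ((n : ℝ) + 1)) * Real.exp (-(c * ((n + 1 : ℕ) : ℝ)))) ≤
      Real.exp (-(c / 2 * n)) := by
    have h4d : 4 * (d : ℝ) ^ 2 = Real.exp L := by rw [hL, Real.exp_log (by positivity)]
    rw [h4d, ← Real.exp_add, ← Real.exp_add]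
    apply Real.exp_le_exp.2
    have hsq := sqrt_linear_bound C hc n
    push_cast
    nlinarith [hnK, hK, hsq, hc]
  rw [div_le_iff₀ hcn]
  calc ((maxDisplacementEvent d n v).card : ℝ)
      ≤ 4 * (d : ℝ) ^ 2 * (Real.exp (C * Real.sqrt ((n : ℝ) + 1)) * Real.exp (-(c * ((n + 1 : ℕ) : ℝ)))) * count d n := hmain
    _ ≤ Real.exp (-(c / 2 * n)) * count d n := mul_le_mul_of_nonneg_right hexp hcn.le

/-- **Theorem 1.1 from K4b + bridgeNotBallistic** (K4a discharged by `axialReduction`).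
[cite: DuminilCopinHammond2013, §2.4 (arXiv v1, p. 10)] -/
theorem thm1_1_of_maxHeightUnfolding
    (hK4b : ∀ (d : ℕ) [NeZero d], 2 ≤ d → ∃ C : ℝ, ∀ (n : ℕ) (H : ℤ),
      (((saws d n).filter fun ω => ∃ k ≤ n, H ≤ ω k 0).card : ℝ) ≤
        Real.exp (C * Real.sqrt ((n : ℝ) + 1)) *
          (((bridges d (n + 1)).filter fun ω => H ≤ ω (n + 1) 0).card : ℝ))
    (hbr : DuminilCopinHammond2013_bridgeNotBallistic) : DuminilCopinHammond2013_thm1_1 :=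
  sec24_of (fun d _ n v hv => axialReduction d n v hv) hK4b hbr

end Literature.Probability.RandomPlanarGeometry.SAW.Zd

end
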